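/-
Copyright (c) 2026. All rights reserved.
Released under Apache 2.0 license as described in the file LICENSE.
Authors: HodgeCM publication cell (pub-hodgecm), GR lane, third hand (`pub-hodgecm-own-crow`).
-/
import Literature.NumberTheory.Weil1964.AdelicMetaplecticUnitaryLeg
import Literature.NumberTheory.Weil1964.AdelicMetaplecticL2Scalar
import Literature.MeasureTheory.Integral.L2ConvergenceOfNormConvergence
import Literature.MeasureTheory.Group.MeasurableHomContinuous
import HarnessLib

/-!
# Strong continuity of the unitary leg of `Mp_ψ(W_𝐀)ᶜᵒⁿᵗ` along sections — without majorants

Topic `NumberTheory/Weil1964`; namespace `Literature.NumberTheory.Weil1964`.  KERNEL ONLY: one definition with body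
(`adelicMpCont.l2Scaling`, the chosen `L²(ν)` scaling constant of `AdelicMetaplecticL2Scalar`) and proved theorems;
nothing of [Weil1964] or [GelbartRogawski1991] asserted.  Stated for the ABSTRACT leg of `AdelicMetaplecticUnitaryLeg`
(`adelicMpCont.unitaryLeg i hd hall ρH hρc hρi` on any complete `H` along any `i : 𝒮(𝐀_Fⁿ) →ₗ[ℂ] H`) whose `i` is
`L²(ν)`-NORMED — `‖i Φ‖² = ∫ ‖Φ‖² dν` — e.g. the class maps into `L²(𝐀_Fⁿ, ν)` (`schwartzBruhatToL2` of
`AdelicMetaplecticUnitaryLegL2`, `piSchwartzBruhatToLp`).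

[GelbartRogawski1991, Prop. 3.1.1 p. 455 L1–2] asks for a CONTINUOUS section `G(𝐀) → Mp_𝐀(W)`; in print's topology the
operator half is the strong continuity `g ↦ U_{s g} f`.  `AdelicMetaplecticUnitaryLeg` §4 reduces it, along a map `t`, to
the continuity of `z ↦ i(ω(t z)Φ)` for `Φ ∈ 𝒮(𝐀_Fⁿ)`.  This file proves that the latter follows from the continuity of
`t` for the COEFFICIENT topology of the tree's `Mp_ψ(W_𝐀)` (`AdelicMetaplecticGroup` §4: `π`-orbits and pointwise values
`(ω(p)Φ)(x)`) — with NO dominated-convergence majorant: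

* §1 **`continuous_apply_of_continuous_coe_of_continuous_lintegral`**: a family `z ↦ Ψ z` of Schwartz–Bruhat functions
  over a sequential space that is POINTWISE continuous with continuous `L²(ν)` norms `z ↦ ∫⁻‖Ψ z‖ₑ² dν` is continuous
  through `i` — Riesz / Brezis–Lieb along sequences (`Literature.MeasureTheory.Integral.L2ConvergenceOfNormConvergence`)
  and `‖i(Ψ z_k - Ψ z)‖² = ∫‖Ψ z_k - Ψ z‖²`; whence `adelicMpCont.continuous_toOp_unitaryLeg_comp_apply_of_continuous`
  (coefficient-continuous `t` + continuous norms ⇒ strong continuity of the leg along `t`);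
* §2 the `L²` scaling **`adelicMpCont.l2Scaling ν p ∈ (0, ∞)`** (`∫⁻‖ω(p)Φ‖ₑ² = l2Scaling p · ∫⁻‖Φ‖ₑ²`,
  `exists_lintegral_enorm_sq_omega_eq_mul`) is MULTIPLICATIVE (`l2Scaling_mul`) and, along a homomorphism
  `s : G →* Mp_ψ(W_𝐀)ᶜᵒⁿᵗ` from a second-countable locally compact metrizable group that is continuous for the coefficient
  topology, Borel measurable (separately continuous integrand ⇒ jointly measurable; Tonelli), hence CONTINUOUS by
  Steinhaus–Weil (`Literature.MeasureTheory.Group.MeasurableHomContinuous`): `adelicMpCont.continuous_l2Scaling_comp_hom`;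
* §3 **`adelicMpCont.continuous_toOp_unitaryLeg_comp_hom`**: the unitary leg is STRONGLY CONTINUOUS along every
  coefficient-continuous homomorphic section — the operator half of the printed "continuous section" clause, for every
  `L²(ν)`-normed model, reduces to the coefficient-continuity of the section of record.  (The GR-2 lane's
  `AdelicMetaplecticL2Continuity` reaches `L²`-continuity along a section by a square-integrable majorant [Weil1964,
  n° 41 Lemme 5]; this route is independent of it.)

## References
* [GelbartRogawski1991] S. Gelbart, J. Rogawski, Invent. Math. 105 (1991) 445–472, §3.1 p. 454, Prop. 3.1.1 p. 455 L1–2.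
* [Weil1964] A. Weil, Acta Math. 111 (1964) 143–211, Chap. I n° 13 p. 160, Chap. III n° 39 p. 189.
* [LiebLoss2001] E. H. Lieb, M. Loss, *Analysis*, 2nd ed. (2001), Thm. 1.9.
* [HewittRoss1979] E. Hewitt, K. A. Ross, *Abstract Harmonic Analysis I*, 2nd ed. (1979), Thm. 22.18.
-/

set_option autoImplicit false

noncomputable section

open scoped Matrix ENNReal NNReal
open NumberField MeasureTheory MeasureTheory.Measure Filter

namespace Literature.NumberTheory.Weil1964

open Literature.NumberTheory.Automorphic Literature.RepresentationTheory.HeisenbergGroup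
  Literature.RepresentationTheory.Unitary

variable (F : Type) [Field F] [NumberField F] {n : ℕ}
variable (T : Matrix (Fin n) (Fin n) (AdeleRing (𝓞 F) F)) (hT : IsUnit T.det)
variable [MeasurableSpace (AdeleRing (𝓞 F) F)] [BorelSpace (AdeleRing (𝓞 F) F)]
  (ν : Measure (Fin n → AdeleRing (𝓞 F) F)) [ν.IsAddHaarMeasure]
variable {H : Type*} [NormedAddCommGroup H] [NormedSpace ℂ H]
  (i : piSchwartzBruhat F (Fin n) →ₗ[ℂ] H)
  (hi : ∀ Φ : piSchwartzBruhat F (Fin n),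
    ‖i Φ‖ ^ 2 = (∫⁻ x, ‖(Φ : (Fin n → AdeleRing (𝓞 F) F) → ℂ) x‖ₑ ^ 2 ∂ν).toReal)

/-! ## §1 Pointwise continuity and continuity of the `L²` norms give continuity through `i` -/

omit [BorelSpace (AdeleRing (𝓞 F) F)] [ν.IsAddHaarMeasure] in
include hi in
/-- in an `L²(ν)`-normed embedding, `‖i Ψ‖ = √(∫⁻ ‖Ψ‖ₑ² dν)`. [cite: Weil1964, Chap. I n° 11] -/
theorem norm_apply_eq_sqrt_lintegral (Ψ : piSchwartzBruhat F (Fin n)) :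
    ‖i Ψ‖ = Real.sqrt ((∫⁻ x, ‖(Ψ : (Fin n → AdeleRing (𝓞 F) F) → ℂ) x‖ₑ ^ 2 ∂ν).toReal) := by
  rw [← hi, Real.sqrt_sq (norm_nonneg _)]

include hi in
/-- **a pointwise-continuous family of Schwartz–Bruhat functions with continuous `L²(ν)` norms is continuous through
every `L²(ν)`-normed embedding** (sequential parameter space): Riesz / Brezis–Lieb along each sequence `z_k → z`
(`Literature.MeasureTheory.Integral.tendsto_lintegral_enorm_sub_sq_of_tendsto_ae`) and
`‖i(Ψ z_k) - i(Ψ z)‖² = ∫ ‖Ψ z_k - Ψ z‖² dν`. [cite: LiebLoss2001, Thm. 1.9] -/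
theorem continuous_apply_of_continuous_coe_of_continuous_lintegral {Z : Type*} [TopologicalSpace Z]
    [SequentialSpace Z] (Ψ : Z → piSchwartzBruhat F (Fin n))
    (hpt : ∀ x : Fin n → AdeleRing (𝓞 F) F,
      Continuous fun z => ((Ψ z : piSchwartzBruhat F (Fin n)) : (Fin n → AdeleRing (𝓞 F) F) → ℂ) x)
    (hnorm : Continuous fun z =>
      ∫⁻ x, ‖((Ψ z : piSchwartzBruhat F (Fin n)) : (Fin n → AdeleRing (𝓞 F) F) → ℂ) x‖ₑ ^ 2 ∂ν) :
    Continuous fun z => i (Ψ z) := by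
  refine continuous_iff_seqContinuous.2 fun u z hu => ?_
  rw [tendsto_iff_norm_sub_tendsto_zero]
  have hmeas : ∀ z, AEStronglyMeasurable
      (((Ψ z : piSchwartzBruhat F (Fin n)) : (Fin n → AdeleRing (𝓞 F) F) → ℂ)) ν :=
    fun z => (integrable_of_mem_piSchwartzBruhat (ν := ν) (Ψ z).2).aestronglyMeasurable
  -- `∫⁻ ‖Ψ z_k - Ψ z‖ₑ² → 0`
  have h := Literature.MeasureTheory.Integral.tendsto_lintegral_enorm_sub_sq_of_tendsto_ae
    (f := fun k => ((Ψ (u k) : piSchwartzBruhat F (Fin n)) : (Fin n → AdeleRing (𝓞 F) F) → ℂ))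
    (g := ((Ψ z : piSchwartzBruhat F (Fin n)) : (Fin n → AdeleRing (𝓞 F) F) → ℂ))
    (fun k => hmeas (u k)) (hmeas z)
    (fun k => (lintegral_enorm_sq_lt_top_of_mem_piSchwartzBruhat ν (Ψ (u k)).2).ne)
    (lintegral_enorm_sq_lt_top_of_mem_piSchwartzBruhat ν (Ψ z).2).ne
    (Eventually.of_forall fun x => ((hpt x).tendsto z).comp hu)
    ((hnorm.tendsto z).comp hu)
  -- hence `‖i(Ψ z_k - Ψ z)‖ = √(toReal ∫⁻ ‖Ψ z_k - Ψ z‖ₑ²) → 0`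
  have h2 : Tendsto (fun k => Real.sqrt ((∫⁻ x, ‖((Ψ (u k) : piSchwartzBruhat F (Fin n)) :
      (Fin n → AdeleRing (𝓞 F) F) → ℂ) x - ((Ψ z : piSchwartzBruhat F (Fin n)) :
        (Fin n → AdeleRing (𝓞 F) F) → ℂ) x‖ₑ ^ 2 ∂ν).toReal)) atTop (nhds 0) := by
    have ht := (ENNReal.tendsto_toReal ENNReal.zero_ne_top).comp h
    rw [ENNReal.toReal_zero] at ht
    have hs := (Real.continuous_sqrt.tendsto 0).comp ht
    rwa [Real.sqrt_zero] at hs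
  refine h2.congr fun k => ?_
  rw [Function.comp_apply, ← map_sub, norm_apply_eq_sqrt_lintegral F ν i hi]
  rfl

section Leg

variable [CompleteSpace H] (hd : DenseRange i)
  (hall : ∀ p : adelicMpCont F (Fin n) T, adelicMpCont.toOp F (Fin n) T p ∈ scaledIsometries i)
  (ρH : Representation ℂ (AdelicHeisenberg F (Fin n) T) H) (hρc : ∀ h, Continuous (ρH h))
  (hρi : ∀ (h : AdelicHeisenberg F (Fin n) T) (Φ : piSchwartzBruhat F (Fin n)),
    ρH h (i Φ) = i (adelicSchrodinger F (Fin n) T h Φ))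

include hi in
/-- **strong continuity of the unitary leg along a COEFFICIENT-CONTINUOUS, NORM-CONTINUOUS map**: if
`t : Z → Mp_ψ(W_𝐀)ᶜᵒⁿᵗ` (`Z` sequential) is continuous for the coefficient topology of `Mp_ψ(W_𝐀)` and
`z ↦ ∫⁻ ‖ω(t z)Φ‖ₑ² dν` is continuous for every `Φ ∈ 𝒮(𝐀_Fⁿ)` (e.g. constant), then every orbit map `z ↦ U_{t z} f` of the
leg `unitaryLeg i hd hall ρH hρc hρi` is continuous — no dominating majorant.
[cite: GelbartRogawski1991, Prop. 3.1.1 p. 455 L1–2] [cite: LiebLoss2001, Thm. 1.9] -/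
theorem adelicMpCont.continuous_toOp_unitaryLeg_comp_apply_of_continuous {Z : Type*} [TopologicalSpace Z]
    [SequentialSpace Z] (t : Z → adelicMpCont F (Fin n) T)
    (ht : Continuous fun z => (t z : adelicMp F (Fin n) T))
    (hnorm : ∀ Φ : piSchwartzBruhat F (Fin n), Continuous fun z =>
      ∫⁻ x, ‖((adelicMpCont.omega F (Fin n) T (t z) Φ : piSchwartzBruhat F (Fin n)) :
        (Fin n → AdeleRing (𝓞 F) F) → ℂ) x‖ₑ ^ 2 ∂ν)
    (f : H) :
    Continuous fun z => MpPsi.toOp ρH (adelicMpCont.unitaryLeg i hd hall ρH hρc hρi (t z)) f := by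
  refine adelicMpCont.continuous_toOp_unitaryLeg_comp_apply i hd hall ρH hρc hρi t (fun Φ => ?_) f
  exact continuous_apply_of_continuous_coe_of_continuous_lintegral F ν i hi
    (fun z => adelicMpCont.toOp F (Fin n) T (t z) Φ) (fun x => (continuous_omegaPsi_apply Φ x).comp ht) (hnorm Φ)

end Leg

/-! ## §2 The `L²` scaling and its automatic continuity along homomorphic sections -/

/-- **the `L²(ν)` scaling of `p ∈ Mp_ψ(W_𝐀)ᶜᵒⁿᵗ`**: the constant `c ∈ (0, ∞)` with `∫⁻ ‖ω(p)Φ‖ₑ² dν = c ∫⁻ ‖Φ‖ₑ² dν`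
for all `Φ ∈ 𝒮(𝐀_Fⁿ)` (`AdelicMetaplecticL2Scalar`; chosen — it is unique). [cite: Weil1964, Chap. I n° 13 p. 160] -/
def adelicMpCont.l2Scaling (p : adelicMpCont F (Fin n) T) : ℝ≥0∞ :=
  Classical.choose (adelicMpCont.exists_lintegral_enorm_sq_omega_eq_mul F ν T hT p)

/-- `l2Scaling p ≠ 0`. [cite: Weil1964, Chap. I n° 13 p. 160] -/
theorem adelicMpCont.l2Scaling_ne_zero (p : adelicMpCont F (Fin n) T) : adelicMpCont.l2Scaling F T hT ν p ≠ 0 :=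
  (Classical.choose_spec (adelicMpCont.exists_lintegral_enorm_sq_omega_eq_mul F ν T hT p)).1

/-- `l2Scaling p ≠ ∞`. [cite: Weil1964, Chap. I n° 13 p. 160] -/
theorem adelicMpCont.l2Scaling_ne_top (p : adelicMpCont F (Fin n) T) : adelicMpCont.l2Scaling F T hT ν p ≠ ∞ :=
  (Classical.choose_spec (adelicMpCont.exists_lintegral_enorm_sq_omega_eq_mul F ν T hT p)).2.1

/-- the defining identity `∫⁻ ‖ω(p)Φ‖ₑ² dν = l2Scaling p · ∫⁻ ‖Φ‖ₑ² dν`. [cite: Weil1964, Chap. I n° 13 p. 160] -/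
theorem adelicMpCont.lintegral_enorm_sq_omega (p : adelicMpCont F (Fin n) T) (Φ : piSchwartzBruhat F (Fin n)) :
    ∫⁻ x, ‖((adelicMpCont.omega F (Fin n) T p Φ : piSchwartzBruhat F (Fin n)) :
        (Fin n → AdeleRing (𝓞 F) F) → ℂ) x‖ₑ ^ 2 ∂ν =
      adelicMpCont.l2Scaling F T hT ν p * ∫⁻ x, ‖(Φ : (Fin n → AdeleRing (𝓞 F) F) → ℂ) x‖ₑ ^ 2 ∂ν :=
  (Classical.choose_spec (adelicMpCont.exists_lintegral_enorm_sq_omega_eq_mul F ν T hT p)).2.2 Φ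

/-- **multiplicativity**: `l2Scaling (p q) = l2Scaling p · l2Scaling q`. [cite: Weil1964, Chap. I n° 13 p. 160] -/
theorem adelicMpCont.l2Scaling_mul (p q : adelicMpCont F (Fin n) T) :
    adelicMpCont.l2Scaling F T hT ν (p * q) = adelicMpCont.l2Scaling F T hT ν p * adelicMpCont.l2Scaling F T hT ν q :=
  adelicMpCont.lintegral_enorm_sq_omega_scalar_mul F ν T p q (adelicMpCont.lintegral_enorm_sq_omega F T hT ν p)
    (adelicMpCont.lintegral_enorm_sq_omega F T hT ν q) (adelicMpCont.lintegral_enorm_sq_omega F T hT ν (p * q))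

/-- the scaling read off ONE test vector: `l2Scaling p = ∫⁻ ‖ω(p)Φ₀‖ₑ² / ∫⁻ ‖Φ₀‖ₑ²` whenever `0 < ∫⁻ ‖Φ₀‖ₑ² < ∞`.
[cite: Weil1964, Chap. I n° 13 p. 160] -/
theorem adelicMpCont.l2Scaling_eq_div (p : adelicMpCont F (Fin n) T) {Φ₀ : piSchwartzBruhat F (Fin n)}
    (h0 : ∫⁻ x, ‖(Φ₀ : (Fin n → AdeleRing (𝓞 F) F) → ℂ) x‖ₑ ^ 2 ∂ν ≠ 0)
    (htop : ∫⁻ x, ‖(Φ₀ : (Fin n → AdeleRing (𝓞 F) F) → ℂ) x‖ₑ ^ 2 ∂ν ≠ ∞) :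
    adelicMpCont.l2Scaling F T hT ν p =
      (∫⁻ x, ‖((adelicMpCont.omega F (Fin n) T p Φ₀ : piSchwartzBruhat F (Fin n)) :
        (Fin n → AdeleRing (𝓞 F) F) → ℂ) x‖ₑ ^ 2 ∂ν) / ∫⁻ x, ‖(Φ₀ : (Fin n → AdeleRing (𝓞 F) F) → ℂ) x‖ₑ ^ 2 ∂ν := by
  rw [ENNReal.eq_div_iff h0 htop, mul_comm]
  exact (adelicMpCont.lintegral_enorm_sq_omega F T hT ν p Φ₀).symm

section Hom

variable {G : Type*} [Group G] [TopologicalSpace G] [IsTopologicalGroup G] [LocallyCompactSpace G]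
  [SecondCountableTopology G] [TopologicalSpace.MetrizableSpace G] [MeasurableSpace G] [BorelSpace G]
  (s : G →* adelicMpCont F (Fin n) T) (hs : Continuous fun g => (s g : adelicMp F (Fin n) T))

omit [IsTopologicalGroup G] [LocallyCompactSpace G] in
include hs in
/-- along a coefficient-continuous map, `g ↦ ∫⁻ ‖ω(s g)Φ‖ₑ² dν` is Borel measurable (the integrand is continuous in
`g` for each `x` and continuous in `x` for each `g`, hence jointly measurable; Tonelli). [folklore] -/
private theorem measurable_lintegral_enorm_sq_omega_comp (Φ : piSchwartzBruhat F (Fin n)) :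
    Measurable fun g => ∫⁻ x, ‖((adelicMpCont.omega F (Fin n) T (s g) Φ : piSchwartzBruhat F (Fin n)) :
      (Fin n → AdeleRing (𝓞 F) F) → ℂ) x‖ₑ ^ 2 ∂ν := by
  haveI := secondCountableTopology_adeleRing F
  haveI := locallyCompactSpace_adeleRing' F
  haveI := t2Space_adeleRing F
  haveI : BorelSpace (Fin n → AdeleRing (𝓞 F) F) := Pi.borelSpace
  have hu : Measurable (Function.uncurry fun (g : G) (x : Fin n → AdeleRing (𝓞 F) F) =>
      ‖((adelicMpCont.omega F (Fin n) T (s g) Φ : piSchwartzBruhat F (Fin n)) :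
        (Fin n → AdeleRing (𝓞 F) F) → ℂ) x‖ₑ ^ 2) := by
    refine measurable_uncurry_of_continuous_of_measurable (fun x => ?_) (fun g => ?_)
    · exact (ENNReal.continuous_pow 2).comp ((continuous_omegaPsi_apply Φ x).comp hs).enorm
    · exact (continuous_of_mem_piSchwartzBruhat (adelicMpCont.omega F (Fin n) T (s g) Φ).2).measurable.enorm.pow_const 2
  exact hu.lintegral_prod_right

include hs in
/-- **the `L²` scaling is continuous along a coefficient-continuous homomorphism** from a second-countable locally
compact metrizable group: it is multiplicative and Borel measurable, so Steinhaus–Weil applies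
(`Literature.MeasureTheory.Group.continuous_of_map_mul_mul_of_measurable_of_pos`). [cite: HewittRoss1979, Thm. 22.18]
[cite: Weil1964, Chap. I n° 13 p. 160] -/
theorem adelicMpCont.continuous_l2Scaling_comp_hom :
    Continuous fun g => (adelicMpCont.l2Scaling F T hT ν (s g)).toReal := by
  obtain ⟨Φ₀, h0, htop⟩ := exists_lintegral_enorm_sq_pos_lt_top F ν (n := n)
  have heq : ∀ g, adelicMpCont.l2Scaling F T hT ν (s g) =
      (∫⁻ x, ‖((adelicMpCont.omega F (Fin n) T (s g) Φ₀ : piSchwartzBruhat F (Fin n)) :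
        (Fin n → AdeleRing (𝓞 F) F) → ℂ) x‖ₑ ^ 2 ∂ν) / ∫⁻ x, ‖(Φ₀ : (Fin n → AdeleRing (𝓞 F) F) → ℂ) x‖ₑ ^ 2 ∂ν :=
    fun g => adelicMpCont.l2Scaling_eq_div F T hT ν (s g) h0.ne' htop.ne
  have hmeas : Measurable fun g => (adelicMpCont.l2Scaling F T hT ν (s g)).toReal := by
    refine ENNReal.measurable_toReal.comp ?_
    simp_rw [heq]
    exact (measurable_lintegral_enorm_sq_omega_comp F T ν s hs Φ₀).div_const _
  refine Literature.MeasureTheory.Group.continuous_of_map_mul_mul_of_measurable_of_pos (fun a b => ?_) (fun a => ?_)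
    hmeas
  · exact ((congrArg (fun p => (adelicMpCont.l2Scaling F T hT ν p).toReal) (s.map_mul a b)).trans
      (congrArg ENNReal.toReal (adelicMpCont.l2Scaling_mul F T hT ν (s a) (s b)))).trans ENNReal.toReal_mul
  · exact ENNReal.toReal_pos (adelicMpCont.l2Scaling_ne_zero F T hT ν (s a)) (adelicMpCont.l2Scaling_ne_top F T hT ν (s a))

include hT hs in
/-- the `L²` norms `g ↦ ∫⁻ ‖ω(s g)Φ‖ₑ² dν` are continuous along a coefficient-continuous homomorphism.
[cite: Weil1964, Chap. I n° 13 p. 160] [cite: HewittRoss1979, Thm. 22.18] -/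
theorem adelicMpCont.continuous_lintegral_enorm_sq_omega_comp_hom (Φ : piSchwartzBruhat F (Fin n)) :
    Continuous fun g => ∫⁻ x, ‖((adelicMpCont.omega F (Fin n) T (s g) Φ : piSchwartzBruhat F (Fin n)) :
      (Fin n → AdeleRing (𝓞 F) F) → ℂ) x‖ₑ ^ 2 ∂ν := by
  have hc := adelicMpCont.continuous_l2Scaling_comp_hom F T hT ν s hs
  have hc' : Continuous fun g => adelicMpCont.l2Scaling F T hT ν (s g) := by
    have : (fun g => adelicMpCont.l2Scaling F T hT ν (s g)) =
        fun g => ENNReal.ofReal ((adelicMpCont.l2Scaling F T hT ν (s g)).toReal) :=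
      funext fun g => (ENNReal.ofReal_toReal (adelicMpCont.l2Scaling_ne_top F T hT ν (s g))).symm
    rw [this]
    exact ENNReal.continuous_ofReal.comp hc
  simp_rw [adelicMpCont.lintegral_enorm_sq_omega F T hT ν]
  exact continuous_iff_continuousAt.2 fun g =>
    ENNReal.Tendsto.mul_const (hc'.tendsto g) (Or.inr (lintegral_enorm_sq_lt_top_of_mem_piSchwartzBruhat ν Φ.2).ne)

variable [CompleteSpace H] (hd : DenseRange i)
  (hall : ∀ p : adelicMpCont F (Fin n) T, adelicMpCont.toOp F (Fin n) T p ∈ scaledIsometries i)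
  (ρH : Representation ℂ (AdelicHeisenberg F (Fin n) T) H) (hρc : ∀ h, Continuous (ρH h))
  (hρi : ∀ (h : AdelicHeisenberg F (Fin n) T) (Φ : piSchwartzBruhat F (Fin n)),
    ρH h (i Φ) = i (adelicSchrodinger F (Fin n) T h Φ))

/-! ## §3 Strong continuity along every coefficient-continuous homomorphic section -/

include hT hi hs in
/-- **STRONG CONTINUITY OF THE UNITARY LEG ALONG EVERY COEFFICIENT-CONTINUOUS HOMOMORPHIC SECTION**: for a
homomorphism `s : G →* Mp_ψ(W_𝐀)ᶜᵒⁿᵗ` from a second-countable locally compact metrizable group that is continuous for the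
coefficient topology of `Mp_ψ(W_𝐀)` (all `g ↦ π(s g) w` and `g ↦ (ω(s g)Φ)(x)` continuous), every orbit map
`g ↦ U_{s g} f`, `f ∈ H`, of the unitary leg on an `L²(ν)`-normed completion is continuous — the operator half of print's
"continuous section" clause along `s`, with no majorant and no norm hypothesis.
[cite: GelbartRogawski1991, Prop. 3.1.1 p. 455 L1–2] [cite: HewittRoss1979, Thm. 22.18] -/
theorem adelicMpCont.continuous_toOp_unitaryLeg_comp_hom (f : H) :
    Continuous fun g => MpPsi.toOp ρH (adelicMpCont.unitaryLeg i hd hall ρH hρc hρi (s g)) f :=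
  adelicMpCont.continuous_toOp_unitaryLeg_comp_apply_of_continuous F T ν i hi hd hall ρH hρc hρi (fun g => s g) hs
    (adelicMpCont.continuous_lintegral_enorm_sq_omega_comp_hom F T hT ν s hs) f

end Hom

end Literature.NumberTheory.Weil1964

end
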